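import Summits.ResolutionOfSingularities.ResolutionOfSingularities.Theses.Descent
import Summits.ResolutionOfSingularities.ResolutionOfSingularities.Theses.EscapeRate
import Summits.ResolutionOfSingularities.ResolutionOfSingularities.Theses.RadicialJung
import Summits.ResolutionOfSingularities.ResolutionOfSingularities.Theorems.DescentDescentPerfectToAllOfCleanModels
import Summits.ResolutionOfSingularities.ResolutionOfSingularities.Theorems.DescentDescentPerfectToAllOfCleanModelsDimGEFour
import Summits.ResolutionOfSingularities.ResolutionOfSingularities.Theorems.RadicialJungCleanModelsT2CleanModelsDimLETwoOverField
import Literature.AlgebraicGeometry.Resolution.EmbeddedResolutionCurvesInSurfaces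
import HarnessLib

/-!
# Crux `DescentPerfectToAll` (stmt-ResolutionOfSingularities-0549) — line `via-clean-models`, rev 3
# (lead `res-B-lead-1` g0, 2026-08-28: support glue G1 LANDED ⇒ the register reads ONE research stub modulo Cossart–Piltant)

Line card: `Lines/via-clean-models.md`.  Rev 2 (registrar `res-B-lens-1`, critic PASS res-B-crit-1 #51) cut the lead's single stub
`stub_cleanModels ≡ stmt-15917` by dimension into `stub_stacks0BICLocus` (F-75c) / `stub_cleanModelsDimThree` / `stub_cleanModelsDimGEFour`.
Rev 3 executes the card's support glue **G1** (critic sharpening s1, «FIRST support task»), now LANDED as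
`Theorems/DescentDescentPerfectToAllOfCleanModelsDimGEFour.lean` (p654205, 2026-08-28T17:47Z):
`CossartPiltant2019 ∧ CleanModels|_{dim W ≥ 4} ⟹ DegP_p (all dims) ⟹ Picover ⟹ DescentPerfectToAll` — the degree-`p` residue is
dimension-graded in the tree (`Picover.DegPDimLeThree.picoverDegP_of_dim_le_three (hCP)` for `dim W ≤ 3`, `cleanResolves_proof` +
the clean model for `dim W ≥ 4`), so the one-root chain `descentPerfectToAll_of_picover` needs no re-threading.

## What is kernel-checked today (2026-08-28) — nothing below is new mathematics
* `CleanModels → Picover → DescentPerfectToAll` sorry-free (`Theorems/DescentDescentPerfectToAllOfCleanModels.lean`, p536972);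
* `CossartPiltant2019 → CleanModels|_{dim W ≥ 4} → DescentPerfectToAll` sorry-free (G1, p654205);
* `CleanModels` in dimension `≤ 2` over every field modulo F-75c (`cleanModels_dimLETwo_of_f75c`, p578792).

## The cut (this file) — two registered stubs, composition kernel-checked
* `stub_cossartPiltant2019` : the tree's named fact `Literature.AlgebraicGeometry.Resolution.CossartPiltant2019` (Cossart–Piltant 2019
  Thm 1.1: reduced separated schemes of finite type of dimension `≤ 3` over any field have a resolution) — a PRINTED THEOREM, typed and
  undischarged in the tree (discharge = a campaign of its own, LADDER §4 «not ordered»); it replaces rev 2's `stub_stacks0BICLocus` and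
  `stub_cleanModelsDimThree` for the purpose of rung B (those two remain debts of crux stmt-15917 `RadicialJung.CleanModels`, whose own
  skeleton `Cruxes/CleanModels/Lines/Sketch.lean` rev 11 carries them; by `descentPerfectToAll_of_dimGtThree (hCP)` rung B lives in `dim ≥ 4`);
* `stub_cleanModelsDimGEFour` : `CleanModels` for `dim W ≥ 4` over every field — OPEN, ON `DimensionFourFrontier`; THE HARDEST (and now the
  ONLY research) STUB; unchanged from rev 2 (signature byte-identical); no prover-hour is spent on it (director BLOCK 54 (A)).
* `DescentPerfectToAll_of` : the two stub statements → the crux BY NAME (`Theses.EscapeRate.DescentPerfectToAll`), and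
  `DescentPerfectToAll_proof` : the item's own decl `Theses.Descent.DescentPerfectToAll` from the two stubs by name — the register's
  skeleton theorem.  Register reading: **rung B = `CleanModels` in `dim ≥ 4` over arbitrary fields, modulo `CossartPiltant2019`.**

DEDUP: ONE lead on 15917 (this seat), never a second one seated from 0549.  Resolution of singularities in characteristic `p` is NOT
proved by anything here; rung B (`DescentPerfectToAll`) and `CleanModels` in `dim ≥ 3` remain OPEN.
-/

noncomputable section

set_option linter.dupNamespace false

open CategoryTheory AlgebraicGeometry

namespace Summit.ResolutionOfSingularities.ResolutionOfSingularities.Cruxes.DescentPerfectToAll.ViaCleanModels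

/-- STUB 1 (named fact of the tree, printed theorem; replaces rev 2's F-75c and dim-3 stubs for rung B): Cossart–Piltant 2019,
Thm 1.1 — every reduced separated scheme of finite type of dimension `≤ 3` over any field has a resolution of singularities.
Typed in the tree as `Literature.AlgebraicGeometry.Resolution.CossartPiltant2019` (undischarged named fact; consumers take it as a
hypothesis). [cite: CossartPiltant2019, Thm. 1.1] -/
theorem stub_cossartPiltant2019 :
    Literature.AlgebraicGeometry.Resolution.CossartPiltant2019.{0} := by
  sorry

/-- STUB 2 (OPEN — the hardest and only research stub; no print): `RadicialJung.CleanModels` restricted to `dim W ≥ 4` over ANY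
field of characteristic `p` = log-clean principalisation of the `K(W)^p`-line of one `g ∈ K(W) ∖ K(W)^p` on a regular `d`-fold,
`d ≥ 4`, by a proper birational regular modification — local-uniformisation-strength order reduction for the radicial hypersurface
`z^p = g`, imperfect residue fields allowed (the wound-point regime of rung B).  ON `Literature.Barriers.ResolutionOfSingularities.
DimensionFourFrontier`.  Signature byte-identical to rev 2. [cite: HauserPerlega2019; CossartPiltant2019; Temkin2013 (arXiv:0804.1554) §1.3] -/
theorem stub_cleanModelsDimGEFour :
    ∀ p : ℕ, p.Prime → ∀ (k : Type) [Field k] [CharP k p] (W : AlgebraicGeometry.Scheme.{0}) [AlgebraicGeometry.IsIntegral W] (f : W ⟶ AlgebraicGeometry.Spec (.of k)) (L : Type) [Field L] [Algebra W.functionField L], AlgebraicGeometry.IsSeparated f → AlgebraicGeometry.LocallyOfFiniteType f → AlgebraicGeometry.QuasiCompact f → Literature.AlgebraicGeometry.Resolution.Scheme.IsRegular W → IsPurelyInseparable W.functionField L → Module.finrank W.functionField L = p → ¬ topologicalKrullDim W ≤ 3 → ∃ (V : AlgebraicGeometry.Scheme.{0}) (π : V ⟶ W) (_ : AlgebraicGeometry.IsIntegral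 V) (_ : AlgebraicGeometry.IsDominant π), AlgebraicGeometry.IsProper π ∧ Literature.AlgebraicGeometry.Resolution.IsBirational π ∧ Literature.AlgebraicGeometry.Resolution.Scheme.IsRegular V ∧ (∀ v : V, (∃ (y : L) (g : W.functionField), y ∉ Set.range (algebraMap W.functionField L) ∧ algebraMap W.functionField L g = y ^ p ∧ ((∃ (d m : ℕ) (hmd : m ≤ d) (t : Fin d → V.presheaf.stalk v) (a : Fin m → ℕ), Ideal.span (Set.range t) = IsLocalRing.maximalIdeal (V.presheaf.stalk v) ∧ ringKrullDim (V.presheaf.stalk v) = (d : WithBot ℕ∞) ∧ 0 < m ∧ (∀ i, ¬ p ∣ a i) ∧ Literature.AlgebraicGeometry.Motives.RatFn.functionFieldMap π g = ∏ i : Fin m, (algebraMap (V.presheaf.stalk v) V.functionField (t (Fin.castLE hmd i))) ^ (a i)) ∨ (∃ u₀ : V.presheaf.stalk v, IsUnit u₀ ∧ Literature.AlgebraicGeometry.Motives.RatFn.functionFieldMap π g = algebraMap (V.presheaf.stalk v) V.functionField u₀ ∧ ((∀ c : V.presheaf.stalk v, u₀ - c ^ p ∉ IsLocalRing.maximalIdeal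 (V.presheaf.stalk v)) ∨ (∃ c : V.presheaf.stalk v, u₀ - c ^ p ∈ IsLocalRing.maximalIdeal (V.presheaf.stalk v) ∧ u₀ - c ^ p ∉ IsLocalRing.maximalIdeal (V.presheaf.stalk v) ^ 2)))))) := by
  sorry

/-- COMPOSITION concluding the crux BY NAME (the `EscapeRate` copy, rfl-equal to the item decl): the two stub statements imply
`DescentPerfectToAll` through the landed G1 `Theorems.escapeRate_descentPerfectToAll_of_cleanModelsDimGEFour` (p654205).
[cite: CossartPiltant2019, Thm. 1.1] -/
theorem DescentPerfectToAll_of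
    (hCP : Literature.AlgebraicGeometry.Resolution.CossartPiltant2019.{0})
    (h4 : ∀ p : ℕ, p.Prime → ∀ (k : Type) [Field k] [CharP k p] (W : AlgebraicGeometry.Scheme.{0}) [AlgebraicGeometry.IsIntegral W] (f : W ⟶ AlgebraicGeometry.Spec (.of k)) (L : Type) [Field L] [Algebra W.functionField L], AlgebraicGeometry.IsSeparated f → AlgebraicGeometry.LocallyOfFiniteType f → AlgebraicGeometry.QuasiCompact f → Literature.AlgebraicGeometry.Resolution.Scheme.IsRegular W → IsPurelyInseparable W.functionField L → Module.finrank W.functionField L = p → ¬ topologicalKrullDim W ≤ 3 → ∃ (V : AlgebraicGeometry.Scheme.{0}) (π : V ⟶ W) (_ : AlgebraicGeometry.IsIntegral V) (_ : AlgebraicGeometry.IsDominant π), AlgebraicGeometry.IsProper π ∧ Literature.AlgebraicGeometry.Resolution.IsBirational π ∧ Literature.AlgebraicGeometry.Resolution.Scheme.IsRegular V ∧ (∀ v : V, (∃ (y : L) (g : W.functionField), y ∉ Set.range (algebraMap W.functionField L) ∧ algebraMap W.functionField L g = y ^ p ∧ ((∃ (d m : ℕ) (hmd : m ≤ d) (t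 : Fin d → V.presheaf.stalk v) (a : Fin m → ℕ), Ideal.span (Set.range t) = IsLocalRing.maximalIdeal (V.presheaf.stalk v) ∧ ringKrullDim (V.presheaf.stalk v) = (d : WithBot ℕ∞) ∧ 0 < m ∧ (∀ i, ¬ p ∣ a i) ∧ Literature.AlgebraicGeometry.Motives.RatFn.functionFieldMap π g = ∏ i : Fin m, (algebraMap (V.presheaf.stalk v) V.functionField (t (Fin.castLE hmd i))) ^ (a i)) ∨ (∃ u₀ : V.presheaf.stalk v, IsUnit u₀ ∧ Literature.AlgebraicGeometry.Motives.RatFn.functionFieldMap π g = algebraMap (V.presheaf.stalk v) V.functionField u₀ ∧ ((∀ c : V.presheaf.stalk v, u₀ - c ^ p ∉ IsLocalRing.maximalIdeal (V.presheaf.stalk v)) ∨ (∃ c : V.presheaf.stalk v, u₀ - c ^ p ∈ IsLocalRing.maximalIdeal (V.presheaf.stalk v) ∧ u₀ - c ^ p ∉ IsLocalRing.maximalIdeal (V.presheaf.stalk v) ^ 2))))))) :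
    Summit.ResolutionOfSingularities.ResolutionOfSingularities.Theses.EscapeRate.DescentPerfectToAll :=
  Summit.ResolutionOfSingularities.ResolutionOfSingularities.Theorems.escapeRate_descentPerfectToAll_of_cleanModelsDimGEFour hCP h4

/-- THE SKELETON THEOREM for the register (`#h21_check_skeleton`): the item's own decl `Theses.Descent.DescentPerfectToAll` from the
two DECLARED STUBS by name (sorried) — through the landed G1 `Theorems.descentPerfectToAll_of_cleanModelsDimGEFour` (p654205).
No other hypothesis. [cite: CossartPiltant2019, Thm. 1.1] -/
theorem DescentPerfectToAll_proof :
    Summit.ResolutionOfSingularities.ResolutionOfSingularities.Theses.Descent.DescentPerfectToAll :=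
  Summit.ResolutionOfSingularities.ResolutionOfSingularities.Theorems.descentPerfectToAll_of_cleanModelsDimGEFour
    stub_cossartPiltant2019 stub_cleanModelsDimGEFour

/-- Rev-2 compatibility (kept for the record, kernel-checked): the rev-2 stub triple still gives the crux — `CleanModels` by
`cleanModels_dimLETwo_of_f75c` / the dim-3 slice / the dim-≥4 slice, then p536972.  Shows rev 3 only DROPS load from rung B. [folklore] -/
theorem DescentPerfectToAll_of_rev2
    (h75c : Literature.AlgebraicGeometry.Resolution.Stacks0BIC_embeddedResolutionCurvesInSurfaces_locus.{0})
    (h3 : ∀ p : ℕ, p.Prime → ∀ (k : Type) [Field k] [CharP k p] (W : AlgebraicGeometry.Scheme.{0}) [AlgebraicGeometry.IsIntegral W] (f : W ⟶ AlgebraicGeometry.Spec (.of k)) (L : Type) [Field L] [Algebra W.functionField L], AlgebraicGeometry.IsSeparated f → AlgebraicGeometry.LocallyOfFiniteType f → AlgebraicGeometry.QuasiCompact f → Literature.AlgebraicGeometry.Resolution.Scheme.IsRegular W → IsPurelyInseparable W.functionField L → Module.finrank W.functionField L = p → ¬ topologicalKrullDim W ≤ 2 → topologicalKrullDim W ≤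 3 → ∃ (V : AlgebraicGeometry.Scheme.{0}) (π : V ⟶ W) (_ : AlgebraicGeometry.IsIntegral V) (_ : AlgebraicGeometry.IsDominant π), AlgebraicGeometry.IsProper π ∧ Literature.AlgebraicGeometry.Resolution.IsBirational π ∧ Literature.AlgebraicGeometry.Resolution.Scheme.IsRegular V ∧ (∀ v : V, (∃ (y : L) (g : W.functionField), y ∉ Set.range (algebraMap W.functionField L) ∧ algebraMap W.functionField L g = y ^ p ∧ ((∃ (d m : ℕ) (hmd : m ≤ d) (t : Fin d → V.presheaf.stalk v) (a : Fin m → ℕ), Ideal.span (Set.range t) = IsLocalRing.maximalIdeal (V.presheaf.stalk v) ∧ ringKrullDim (V.presheaf.stalk v) = (d : WithBot ℕ∞) ∧ 0 < m ∧ (∀ i, ¬ p ∣ a i) ∧ Literature.AlgebraicGeometry.Motives.RatFn.functionFieldMap π g = ∏ i : Fin m, (algebraMap (V.presheaf.stalk v) V.functionField (t (Fin.castLE hmd i))) ^ (a i)) ∨ (∃ u₀ : V.presheaf.stalk v, IsUnit u₀ ∧ Literature.AlgebraicGeometry.Motives.RatFn.functionFieldMap π g = algebraMap (V.presheaf.stalk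 v) V.functionField u₀ ∧ ((∀ c : V.presheaf.stalk v, u₀ - c ^ p ∉ IsLocalRing.maximalIdeal (V.presheaf.stalk v)) ∨ (∃ c : V.presheaf.stalk v, u₀ - c ^ p ∈ IsLocalRing.maximalIdeal (V.presheaf.stalk v) ∧ u₀ - c ^ p ∉ IsLocalRing.maximalIdeal (V.presheaf.stalk v) ^ 2)))))))
    (h4 : ∀ p : ℕ, p.Prime → ∀ (k : Type) [Field k] [CharP k p] (W : AlgebraicGeometry.Scheme.{0}) [AlgebraicGeometry.IsIntegral W] (f : W ⟶ AlgebraicGeometry.Spec (.of k)) (L : Type) [Field L] [Algebra W.functionField L], AlgebraicGeometry.IsSeparated f → AlgebraicGeometry.LocallyOfFiniteType f → AlgebraicGeometry.QuasiCompact f → Literature.AlgebraicGeometry.Resolution.Scheme.IsRegular W → IsPurelyInseparable W.functionField L → Module.finrank W.functionField L = p → ¬ topologicalKrullDim W ≤ 3 → ∃ (V : AlgebraicGeometry.Scheme.{0}) (π : V ⟶ W) (_ : AlgebraicGeometry.IsIntegral V) (_ : AlgebraicGeometry.IsDominant π), AlgebraicGeometry.IsProper π ∧ Literature.AlgebraicGeometry.Resolution.IsBirational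 π ∧ Literature.AlgebraicGeometry.Resolution.Scheme.IsRegular V ∧ (∀ v : V, (∃ (y : L) (g : W.functionField), y ∉ Set.range (algebraMap W.functionField L) ∧ algebraMap W.functionField L g = y ^ p ∧ ((∃ (d m : ℕ) (hmd : m ≤ d) (t : Fin d → V.presheaf.stalk v) (a : Fin m → ℕ), Ideal.span (Set.range t) = IsLocalRing.maximalIdeal (V.presheaf.stalk v) ∧ ringKrullDim (V.presheaf.stalk v) = (d : WithBot ℕ∞) ∧ 0 < m ∧ (∀ i, ¬ p ∣ a i) ∧ Literature.AlgebraicGeometry.Motives.RatFn.functionFieldMap π g = ∏ i : Fin m, (algebraMap (V.presheaf.stalk v) V.functionField (t (Fin.castLE hmd i))) ^ (a i)) ∨ (∃ u₀ : V.presheaf.stalk v, IsUnit u₀ ∧ Literature.AlgebraicGeometry.Motives.RatFn.functionFieldMap π g = algebraMap (V.presheaf.stalk v) V.functionField u₀ ∧ ((∀ c : V.presheaf.stalk v, u₀ - c ^ p ∉ IsLocalRing.maximalIdeal (V.presheaf.stalk v)) ∨ (∃ c : V.presheaf.stalk v, u₀ - c ^ p ∈ IsLocalRing.maximalIdeal (V.presheaf.stalk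 v) ∧ u₀ - c ^ p ∉ IsLocalRing.maximalIdeal (V.presheaf.stalk v) ^ 2))))))) :
    Summit.ResolutionOfSingularities.ResolutionOfSingularities.Theses.EscapeRate.DescentPerfectToAll := by
  refine Summit.ResolutionOfSingularities.ResolutionOfSingularities.Theorems.escapeRate_descentPerfectToAll_of_cleanModels ?_
  intro p hp k _ _ W _ f L _ _ hs hl hq hr hpi hd
  by_cases h2 : topologicalKrullDim W ≤ 2
  · haveI := hs; haveI := hl; haveI := hq; haveI := hpi
    exact Summit.ResolutionOfSingularities.ResolutionOfSingularities.Theorems.RadicialJung.CleanModels.cleanModels_dimLETwo_of_f75c h75c p hp k W f hr L hd h2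
  · by_cases h3' : topologicalKrullDim W ≤ 3
    · exact h3 p hp k W f L hs hl hq hr hpi hd h2 h3'
    · exact h4 p hp k W f L hs hl hq hr hpi hd h3'

end Summit.ResolutionOfSingularities.ResolutionOfSingularities.Cruxes.DescentPerfectToAll.ViaCleanModels

end
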